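import Literature.Geometry.Lorentzian.CoordLaplacianPerturbation
import Literature.Geometry.Lorentzian.AsymptoticFlatnessChart
import Literature.Geometry.Lorentzian.DecaySymbols
import Literature.Geometry.Lorentzian.PositiveMassRigidity
import HarnessLib

/-!
# Schoen–Yau 1979, (2.1): `1/r` is strictly superharmonic far out on an end of negative mass

Schoen–Yau, Comm. Math. Phys. 65 (1979), §2 Step 1, (2.1) (p. 48): on an end `N_k` with the
expansion (1.1) `g = (1 + M/2r)⁴ δ + h`, `|h| ≤ k₁ r⁻²`, `|∂h| ≤ k₂ r⁻³`, and `M < 0`, *"direct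
computation shows `Δ(1/r) = (M/r⁴)(1 + O(1/r)) + O(1/r⁵)`, where `Δ` is the Laplace operator of
`ds²`. Thus, in particular, `Δ(1/r) < 0` for `r ≥ σ`"*.

This file proves the coordinate form of that statement for the chart components `hCoeff e D` of
the metric of an asymptotically Schwarzschildean end (`IsAsymptoticallySchwarzschild e D M 2`):

* `AFEnd.eventually_lapAt_hCoeff_inv_norm_le` — for `M < 0`, eventually along
  `Bornology.cobounded E3`, `Δ_G (1/r)(y) ≤ (M/2) ‖y‖⁻⁴` with `G = hCoeff e D` and `Δ_G = lapAt`
  the coordinate Laplace–Beltrami operator (`CoordScalarCurvatureEvolution.lean`);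
* `AFEnd.exists_radius_lapAt_hCoeff_inv_norm_le` — hence a radius `σ ≥ R` beyond which
  `Δ_G (1/r) ≤ (M/2) r⁻⁴ < 0`.

Proof: `G = G₀ + H` with `G₀ = w⁴ δ`, `w = 1 + M/2r`, `H = O(r⁻²)`, `∂H = O(r⁻³)` (the
expansion (1.1)); `Δ_{G₀}(1/r) = M w⁻⁵ r⁻⁴ ≤ M r⁻⁴` exactly (`lapAt_schwarzschild_inv_norm`,
`CoordLaplacianPerturbation.lean`; `0 < w ≤ 1` for `M < 0`), and
`|Δ_G(1/r) − Δ_{G₀}(1/r)| = O(r⁻⁵)` by the perturbation bound `abs_lapAt_sub_lapAt_le` with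
`‖♯_G‖, ‖♯_{G₀}‖ ≤ 2` (coercivity `G(v,v) ≥ ½‖v‖²` far out), `‖♯_G − ♯_{G₀}‖ = O(r⁻²)`
(resolvent identity), `‖D(1/r)‖ = r⁻²`, `‖D²(1/r)‖ ≤ 4 r⁻³`, `‖DG‖ = O(r⁻¹)`,
`‖DG − DG₀‖ = O(r⁻³)`. Everything is proved; no statement of `Prop` type is introduced.

## References

* R. Schoen, S.-T. Yau, *On the proof of the positive mass conjecture in general relativity*,
  Comm. Math. Phys. 65 (1979) 45–76, §1 (1.1) and §2 Step 1, (2.1), p. 48. [SchoenYauPMT1979]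
-/

noncomputable section

set_option maxSynthPendingDepth 3

open Set Filter Asymptotics Bornology Metric ContinuousLinearMap
open scoped Topology ContDiff RealInnerProductSpace Manifold

namespace Literature.Geometry.Lorentzian

open MetricCoord

/-! ### Elementary conversions for decay rates along `cobounded` -/

section Rates

variable {E : Type*} [NormedAddCommGroup E]

/-- `‖x‖^(-k) = (‖x‖^k)⁻¹` for a natural exponent. [folklore] -/
theorem norm_rpow_neg_natCast (x : E) (k : ℕ) : ‖x‖ ^ (-(k : ℝ)) = (‖x‖ ^ k)⁻¹ := by
  rw [Real.rpow_neg (norm_nonneg x), Real.rpow_natCast]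

/-- From an `O(‖x‖^{-k})` bound for a nonnegative quantity to an eventual pointwise bound with a
positive constant. [folklore] -/
theorem exists_pos_eventually_le_of_isBigO {f : E → ℝ} (hf : ∀ x, 0 ≤ f x) {k : ℕ}
    (h : f =O[cobounded E] fun x ↦ ‖x‖ ^ (-(k : ℝ))) :
    ∃ C : ℝ, 0 < C ∧ ∀ᶠ x in cobounded E, f x ≤ C * (‖x‖ ^ k)⁻¹ := by
  obtain ⟨C, hC, hCw⟩ := h.exists_pos
  refine ⟨C, hC, ?_⟩
  filter_upwards [hCw.bound] with x hx
  rw [Real.norm_of_nonneg (hf x), Real.norm_of_nonneg (Real.rpow_nonneg (norm_nonneg x) _),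
    norm_rpow_neg_natCast] at hx
  exact hx

/-- **Derivative of a scalar multiple of a fixed vector**, stated for a general normed space `W`
(used with `W` the space of bilinear forms, where the specialised lemmas elaborate slowly):
`y ↦ c(y) • v` is differentiable with `‖D(c • v)(x)‖ ≤ ‖Dc(x)‖ ‖v‖`. [folklore] -/
theorem differentiableAt_smul_const_norm_le {E W : Type*} [NormedAddCommGroup E] [NormedSpace ℝ E]
    [NormedAddCommGroup W] [NormedSpace ℝ W] {c : E → ℝ} {x : E} (hc : DifferentiableAt ℝ c x)
    (v : W) :
    DifferentiableAt ℝ (fun y ↦ c y • v) x ∧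
      ‖fderiv ℝ (fun y ↦ c y • v) x‖ ≤ ‖fderiv ℝ c x‖ * ‖v‖ := by
  have h := hc.hasFDerivAt.smul_const v
  refine ⟨h.differentiableAt, ?_⟩
  rw [h.fderiv, norm_smulRight_apply]

/-- Evaluation of a scalar multiple of a bilinear form, stated for a general normed space of
values. [folklore] -/
theorem smul_clm_apply₂ {E : Type*} [NormedAddCommGroup E] [NormedSpace ℝ E] (a : ℝ)
    (B : E →L[ℝ] E →L[ℝ] ℝ) (v w : E) : (a • B) v w = a * B v w := rfl

end Rates

/-- Pure real arithmetic: monotonicity of the right-hand side of `abs_lapAt_sub_lapAt_le` in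
each of the (nonnegative) quantities it involves. [folklore] -/
theorem lapAt_bound_aux {A a d₂ e₂ d₁ S dG eG S₀ dGG eGG : ℝ}
    (hA0 : 0 ≤ A) (hA : A ≤ a) (hd₂0 : 0 ≤ d₂) (hd₂ : d₂ ≤ e₂) (hd₁ : 0 ≤ d₁)
    (hS0 : 0 ≤ S) (hS : S ≤ 2) (hdG0 : 0 ≤ dG) (hdG : dG ≤ eG) (hS₀0 : 0 ≤ S₀) (hS₀ : S₀ ≤ 2)
    (hdGG0 : 0 ≤ dGG) (hdGG : dGG ≤ eGG) (ha : 0 ≤ a) (_heG : 0 ≤ eG) :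
    (3 : ℕ) * (A * (d₂ + d₁ * (2⁻¹ * (S * (3 * dG))))
        + S₀ * (d₁ * (2⁻¹ * (3 * (A * dG + S₀ * dGG)))))
      ≤ (3 : ℕ) * (a * (e₂ + d₁ * (2⁻¹ * (2 * (3 * eG))))
        + 2 * (d₁ * (2⁻¹ * (3 * (a * eG + 2 * eGG))))) := by
  have heGG : 0 ≤ eGG := hdGG0.trans hdGG
  have he₂ : 0 ≤ e₂ := hd₂0.trans hd₂
  gcongr

namespace AFEnd

variable {X : Type} [TopologicalSpace X] [ChartedSpace E3 X] [IsManifold (𝓡 3) ∞ X]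
  (e : AFEnd X) (D : InitialDataSet (𝓡 3) X)

/-- The flat bilinear form `δ = ⟪·,·⟫` on `E3` has operator norm at most `1`. [folklore] -/
theorem norm_innerSL_bilin_le_one : ‖(innerSL ℝ : E3 →L[ℝ] E3 →L[ℝ] ℝ)‖ ≤ 1 := by
  refine opNorm_le_bound _ zero_le_one fun v ↦ ?_
  rw [one_mul]
  exact (innerSL_apply_norm ℝ v).le

set_option maxHeartbeats 400000 in
/-- **Schoen–Yau 1979, (2.1): `1/r` is strictly superharmonic far out on an end of negative
mass**, coordinate form. If the chart components `G = hCoeff e D` of the metric have the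
expansion (1.1) with mass `M < 0` (`IsAsymptoticallySchwarzschild e D M 2`), then eventually along
`cobounded E3` the coordinate Laplace–Beltrami operator of `G` satisfies
`Δ_G (1/r)(y) ≤ (M/2) ‖y‖⁻⁴ (< 0)`. Printed: "`Δ(1/r) = (M/r⁴)(1 + O(1/r)) + O(1/r⁵)`. Thus, in
particular, `Δ(1/r) < 0` for `r ≥ σ`." [cite: SchoenYauPMT1979, §2 Step 1, (2.1) (p. 48)] -/
theorem eventually_lapAt_hCoeff_inv_norm_le {M : ℝ} (hAS : IsAsymptoticallySchwarzschild e D M 2)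
    (hM : M < 0) :
    ∀ᶠ y in cobounded E3,
      lapAt (hCoeff e D) (fun z : E3 ↦ ‖z‖⁻¹) y ≤ M / 2 * (‖y‖ ^ 4)⁻¹ := by
  -- notation
  set δ : E3 →L[ℝ] E3 →L[ℝ] ℝ := (innerSL ℝ : E3 →L[ℝ] E3 →L[ℝ] ℝ) with hδdef
  have hδ : ∀ v w : E3, δ v w = ⟪v, w⟫ := fun v w ↦ rfl
  set G : E3 → E3 →L[ℝ] E3 →L[ℝ] ℝ := hCoeff e D with hGdef
  set w : E3 → ℝ := fun y ↦ 1 + M / (2 * ‖y‖) with hwdef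
  set G₀ : E3 → E3 →L[ℝ] E3 →L[ℝ] ℝ := fun y ↦ w y ^ 4 • δ with hG₀def
  set f : E3 → ℝ := fun z ↦ ‖z‖⁻¹ with hfdef
  set b : OrthonormalBasis (Fin 3) ℝ E3 := EuclideanSpace.basisFun (Fin 3) ℝ with hbdef
  -- (1.1): `G - G₀ = O(r⁻²)`, `∂(G - G₀) = O(r⁻³)`
  have hO0 := hAS 0 (by norm_num)
  have hO1 := hAS 1 (by norm_num)
  simp only [Nat.cast_zero, sub_zero, Nat.cast_one] at hO0 hO1
  have hO0' : (fun x ↦ ‖G x - G₀ x‖) =O[cobounded E3] fun x ↦ ‖x‖ ^ (-(2 : ℕ) : ℝ) := by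
    refine (hO0.congr_left fun x ↦ ?_).congr_right fun x ↦ by norm_num
    rw [norm_iteratedFDeriv_zero]
  have hO1' : (fun x ↦ ‖fderiv ℝ (fun y ↦ G y - G₀ y) x‖) =O[cobounded E3]
      fun x ↦ ‖x‖ ^ (-(3 : ℕ) : ℝ) := by
    refine (hO1.congr_left fun x ↦ ?_).congr_right fun x ↦ by norm_num
    rw [norm_iteratedFDeriv_one]
  obtain ⟨C₀, hC₀, hev0⟩ := exists_pos_eventually_le_of_isBigO (fun x ↦ norm_nonneg _) hO0'
  obtain ⟨C₁, hC₁, hev1⟩ := exists_pos_eventually_le_of_isBigO (fun x ↦ norm_nonneg _) hO1'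
  -- `G - G₀ → 0`
  have htend : Tendsto (fun x ↦ ‖G x - G₀ x‖) (cobounded E3) (𝓝 0) := by
    refine hO0'.trans_tendsto ?_
    have h := (tendsto_rpow_neg_atTop (by norm_num : (0 : ℝ) < 2)).comp
      (tendsto_norm_cobounded_atTop (E := E3))
    refine h.congr fun x ↦ ?_
    simp only [Function.comp_apply, Nat.cast_ofNat]
  have hev_small : ∀ᶠ x in cobounded E3, ‖G x - G₀ x‖ ≤ 16⁻¹ :=
    (htend.eventually (ge_mem_nhds (by norm_num : (0 : ℝ) < 16⁻¹)))
  -- the symbol `w⁴ = (1 + M/2r)⁴`: smooth far out with `‖D(w⁴)‖ = O(r⁻¹)`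
  have hw4 : IsBigOSmooth 2 0 fun y : E3 ↦ w y ^ 4 := by
    have h := ((isBigOSmooth_const_add_mul_inv_norm (E := E3) 1 (M / 2)).pow 4)
    refine h.congr fun y ↦ ?_
    simp only [hwdef, div_eq_mul_inv, mul_inv]
    ring
  obtain ⟨R₀, hR₀⟩ := hw4.eventually_contDiffAt
  have hOw : (fun x ↦ ‖fderiv ℝ (fun y : E3 ↦ w y ^ 4) x‖) =O[cobounded E3]
      fun x ↦ ‖x‖ ^ (-(1 : ℕ) : ℝ) := by
    refine ((hw4.isBigO (m := 1) (by norm_num)).congr_left fun x ↦ ?_).congr_right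
      fun x ↦ by norm_num
    rw [norm_iteratedFDeriv_one]
  obtain ⟨C₂, hC₂, hev2⟩ := exists_pos_eventually_le_of_isBigO (fun x ↦ norm_nonneg _) hOw
  -- the final radius condition
  set K : ℝ := 48 * C₀ + 72 * C₀ * (C₂ + C₁) + 18 * C₁ with hKdef
  have hKpos : 0 < K := by positivity
  filter_upwards [hev0, hev1, hev_small, hev2, eventually_cobounded_lt_norm (E := E3) e.R,
    eventually_cobounded_lt_norm (E := E3) R₀,
    eventually_cobounded_le_norm (E := E3) (max (max 1 (4 * |M|)) (-2 * K / M + 1))]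
    with y hy0 hy1 hysmall hy2 hyR hyR₀ hybig
  have hy1' : 1 ≤ ‖y‖ := le_trans (le_trans (le_max_left _ _) (le_max_left _ _)) hybig
  have hyM : 4 * |M| ≤ ‖y‖ := le_trans (le_trans (le_max_right _ _) (le_max_left _ _)) hybig
  have hyK : -2 * K / M + 1 ≤ ‖y‖ := le_trans (le_max_right _ _) hybig
  have hypos : 0 < ‖y‖ := by linarith
  have hy_ne : y ≠ 0 := norm_pos_iff.1 hypos
  have hMy : |M| < ‖y‖ := by linarith [abs_nonneg M]
  -- `w` between `7/8` and `1`
  have hw_le : w y ≤ 1 := by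
    simp only [hwdef]
    have : M / (2 * ‖y‖) ≤ 0 := div_nonpos_of_nonpos_of_nonneg hM.le (by positivity)
    linarith
  have hw_ge : 7 / 8 ≤ w y := by
    simp only [hwdef]
    have h1 : -|M| ≤ M := neg_abs_le M
    have h2 : M / (2 * ‖y‖) ≥ -(8⁻¹) := by
      rw [ge_iff_le, le_div_iff₀ (by positivity)]
      linarith
    linarith
  have hwpos : 0 < w y := by linarith
  have hw4_ge : 58 / 100 ≤ w y ^ 4 := by
    have h := pow_le_pow_left₀ (by norm_num : (0 : ℝ) ≤ 7 / 8) hw_ge 4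
    norm_num at h
    linarith
  have hw4_le : w y ^ 4 ≤ 1 := pow_le_one₀ hwpos.le hw_le
  -- differentiability at `y`
  have hGd : DifferentiableAt ℝ G y := (e.contDiffAt_hCoeff D hyR).differentiableAt (by simp)
  have hw4d : DifferentiableAt ℝ (fun z : E3 ↦ w z ^ 4) y := (hR₀ y hyR₀).differentiableAt (by simp)
  obtain ⟨hG₀d, hG₀n⟩ := differentiableAt_smul_const_norm_le hw4d δ
  have hDG₀ : ‖fderiv ℝ G₀ y‖ ≤ C₂ * (‖y‖ ^ 1)⁻¹ := by
    calc ‖fderiv ℝ G₀ y‖ ≤ ‖fderiv ℝ (fun z : E3 ↦ w z ^ 4) y‖ * ‖δ‖ := hG₀n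
      _ ≤ ‖fderiv ℝ (fun z : E3 ↦ w z ^ 4) y‖ * 1 := by
          gcongr; exact norm_innerSL_bilin_le_one
      _ ≤ C₂ * (‖y‖ ^ 1)⁻¹ := by rw [mul_one]; exact hy2
  have hsplit : fderiv ℝ (fun z ↦ G z - G₀ z) y = fderiv ℝ G y - fderiv ℝ G₀ y :=
    fderiv_fun_sub hGd hG₀d
  rw [hsplit] at hy1
  have hr1 : (‖y‖ ^ 3)⁻¹ ≤ (‖y‖ ^ 1)⁻¹ := by
    rw [pow_one]
    exact inv_anti₀ hypos (le_self_pow₀ hy1' three_ne_zero)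
  have hDG : ‖fderiv ℝ G y‖ ≤ (C₂ + C₁) * (‖y‖ ^ 1)⁻¹ := by
    have h : ‖fderiv ℝ G y‖ ≤ ‖fderiv ℝ G₀ y‖ + ‖fderiv ℝ G y - fderiv ℝ G₀ y‖ := by
      have := norm_add_le (fderiv ℝ G₀ y) (fderiv ℝ G y - fderiv ℝ G₀ y)
      rwa [add_sub_cancel] at this
    have h' : ‖fderiv ℝ G y - fderiv ℝ G₀ y‖ ≤ C₁ * (‖y‖ ^ 1)⁻¹ :=
      hy1.trans (mul_le_mul_of_nonneg_left hr1 hC₁.le)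
    linarith
  -- coercivity and the inverses
  have hcoer : ∀ v : E3, 2⁻¹ * ‖v‖ ^ 2 ≤ G y v v := fun v ↦ by
    have h1 : G y v v = G₀ y v v + (G y - G₀ y) v v := by
      simp only [_root_.sub_apply]; ring
    have h2 : G₀ y v v = w y ^ 4 * ‖v‖ ^ 2 := by
      rw [hG₀def, smul_clm_apply₂, hδ, real_inner_self_eq_norm_sq]
    have h3 : |(G y - G₀ y) v v| ≤ 16⁻¹ * ‖v‖ ^ 2 := by
      calc |(G y - G₀ y) v v| ≤ ‖(G y - G₀ y) v‖ * ‖v‖ := by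
            rw [← Real.norm_eq_abs]; exact le_opNorm _ _
        _ ≤ ‖G y - G₀ y‖ * ‖v‖ * ‖v‖ := by gcongr; exact le_opNorm _ _
        _ ≤ 16⁻¹ * ‖v‖ * ‖v‖ := by gcongr
        _ = 16⁻¹ * ‖v‖ ^ 2 := by ring
    have h4 := neg_abs_le ((G y - G₀ y) v v)
    have h5 := mul_le_mul_of_nonneg_right hw4_ge (sq_nonneg ‖v‖)
    rw [h1, h2]
    linarith [sq_nonneg ‖v‖]
  have hcoer₀ : ∀ v : E3, 2⁻¹ * ‖v‖ ^ 2 ≤ G₀ y v v := fun v ↦ by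
    have h2 : G₀ y v v = w y ^ 4 * ‖v‖ ^ 2 := by
      rw [hG₀def, smul_clm_apply₂, hδ, real_inner_self_eq_norm_sq]
    have h5 := mul_le_mul_of_nonneg_right hw4_ge (sq_nonneg ‖v‖)
    rw [h2]
    linarith [sq_nonneg ‖v‖]
  have hinv : (G y).IsInvertible := isInvertible_of_nondegenerate fun v hv ↦ by
    have h := hcoer v
    rw [hv v] at h
    have : ‖v‖ ^ 2 ≤ 0 := by linarith
    exact norm_eq_zero.1 (pow_eq_zero_iff two_ne_zero |>.1 (le_antisymm this (sq_nonneg _)))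
  have hinv₀ : (G₀ y).IsInvertible := isInvertible_of_nondegenerate fun v hv ↦ by
    have h := hcoer₀ v
    rw [hv v] at h
    have : ‖v‖ ^ 2 ≤ 0 := by linarith
    exact norm_eq_zero.1 (pow_eq_zero_iff two_ne_zero |>.1 (le_antisymm this (sq_nonneg _)))
  have hS : ‖sharpAt G y‖ ≤ 2 := by
    have := norm_sharpAt_le_of_coercive hinv (by norm_num : (0 : ℝ) < 2⁻¹) hcoer
    norm_num at this
    exact this
  have hS₀ : ‖sharpAt G₀ y‖ ≤ 2 := by
    have := norm_sharpAt_le_of_coercive hinv₀ (by norm_num : (0 : ℝ) < 2⁻¹) hcoer₀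
    norm_num at this
    exact this
  have hA : ‖sharpAt G y - sharpAt G₀ y‖ ≤ 4 * C₀ * (‖y‖ ^ 2)⁻¹ := by
    refine (norm_sharpAt_sub_sharpAt_le hinv hinv₀).trans ?_
    calc ‖sharpAt G y‖ * ‖G y - G₀ y‖ * ‖sharpAt G₀ y‖ ≤ 2 * (C₀ * (‖y‖ ^ 2)⁻¹) * 2 := by
          gcongr
      _ = 4 * C₀ * (‖y‖ ^ 2)⁻¹ := by ring
  -- the derivatives of `1/r`
  have hDf : ‖fderiv ℝ f y‖ = (‖y‖ ^ 2)⁻¹ := norm_fderiv_inv_norm hy_ne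
  have hD2f : ‖fderiv ℝ (fderiv ℝ f) y‖ ≤ 4 * (‖y‖ ^ 3)⁻¹ := norm_fderiv_fderiv_inv_norm_le hy_ne
  -- the perturbation bound
  have h3 : Module.finrank ℝ E3 = 3 := finrank_euclideanSpace_fin
  have hpert := abs_lapAt_sub_lapAt_le (G := G) (G₀ := G₀) (y := y) f
  rw [h3] at hpert
  have hbound : (3 : ℕ) *
      (‖sharpAt G y - sharpAt G₀ y‖ * (‖fderiv ℝ (fderiv ℝ f) y‖
          + ‖fderiv ℝ f y‖ * (2⁻¹ * (‖sharpAt G y‖ * (3 * ‖fderiv ℝ G y‖))))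
        + ‖sharpAt G₀ y‖ * (‖fderiv ℝ f y‖ * (2⁻¹ * (3 *
            (‖sharpAt G y - sharpAt G₀ y‖ * ‖fderiv ℝ G y‖
              + ‖sharpAt G₀ y‖ * ‖fderiv ℝ G y - fderiv ℝ G₀ y‖))))) ≤
      (3 : ℕ) *
      (4 * C₀ * (‖y‖ ^ 2)⁻¹ * (4 * (‖y‖ ^ 3)⁻¹
          + (‖y‖ ^ 2)⁻¹ * (2⁻¹ * (2 * (3 * ((C₂ + C₁) * (‖y‖ ^ 1)⁻¹)))))
        + 2 * ((‖y‖ ^ 2)⁻¹ * (2⁻¹ * (3 *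
            (4 * C₀ * (‖y‖ ^ 2)⁻¹ * ((C₂ + C₁) * (‖y‖ ^ 1)⁻¹)
              + 2 * (C₁ * (‖y‖ ^ 3)⁻¹)))))) := by
    rw [hDf]
    exact lapAt_bound_aux (norm_nonneg _) hA (norm_nonneg _) hD2f (by positivity)
      (norm_nonneg _) hS (norm_nonneg _) hDG (norm_nonneg _) hS₀ (norm_nonneg _) hy1
      (by positivity) (by positivity)
  have hKr : (3 : ℕ) *
      (4 * C₀ * (‖y‖ ^ 2)⁻¹ * (4 * (‖y‖ ^ 3)⁻¹
          + (‖y‖ ^ 2)⁻¹ * (2⁻¹ * (2 * (3 * ((C₂ + C₁) * (‖y‖ ^ 1)⁻¹)))))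
        + 2 * ((‖y‖ ^ 2)⁻¹ * (2⁻¹ * (3 *
            (4 * C₀ * (‖y‖ ^ 2)⁻¹ * ((C₂ + C₁) * (‖y‖ ^ 1)⁻¹)
              + 2 * (C₁ * (‖y‖ ^ 3)⁻¹)))))) = K * (‖y‖ ^ 5)⁻¹ := by
    simp only [hKdef, Nat.cast_ofNat]
    field_simp
    ring
  have hdiff : lapAt G f y - lapAt G₀ f y ≤ K * (‖y‖ ^ 5)⁻¹ :=
    ((le_abs_self _).trans hpert).trans (hbound.trans_eq hKr)
  -- the exact flat term
  have hcard : Fintype.card (Fin 3) = 3 := Fintype.card_fin 3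
  have hflat : lapAt G₀ f y = M * (w y ^ 5)⁻¹ * (‖y‖ ^ 4)⁻¹ :=
    lapAt_schwarzschild_inv_norm hδ b hcard M hMy
  have hflat_le : lapAt G₀ f y ≤ M * (‖y‖ ^ 4)⁻¹ := by
    rw [hflat]
    have hw5 : w y ^ 5 ≤ 1 := pow_le_one₀ hwpos.le hw_le
    have hw5pos : 0 < w y ^ 5 := pow_pos hwpos 5
    have hinv5 : 1 ≤ (w y ^ 5)⁻¹ := (one_le_inv₀ hw5pos).2 hw5
    have : M * (w y ^ 5)⁻¹ ≤ M * 1 := mul_le_mul_of_nonpos_left hinv5 hM.le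
    rw [mul_one] at this
    exact mul_le_mul_of_nonneg_right this (by positivity)
  -- the radius condition `K r⁻⁵ ≤ (-M/2) r⁻⁴`
  have htail : K * (‖y‖ ^ 5)⁻¹ ≤ -(M / 2) * (‖y‖ ^ 4)⁻¹ := by
    have h1 : K ≤ -(M / 2) * ‖y‖ := by
      have h0 : -2 * K / M ≤ ‖y‖ - 1 := by linarith
      rw [div_le_iff_of_neg hM] at h0
      ring_nf at h0 ⊢
      linarith
    have h2 : K / ‖y‖ ≤ -(M / 2) := (div_le_iff₀ hypos).2 h1
    have h3 : K * (‖y‖ ^ 5)⁻¹ = K / ‖y‖ * (‖y‖ ^ 4)⁻¹ := by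
      field_simp
    rw [h3]
    exact mul_le_mul_of_nonneg_right h2 (by positivity)
  linarith

/-- **Schoen–Yau 1979, (2.1), radius form**: for an end with the expansion (1.1) of mass
`M < 0` there is `σ ≥ R` with `Δ_G (1/r)(y) ≤ (M/2)‖y‖⁻⁴ < 0` for all `‖y‖ ≥ σ`
(`G = hCoeff e D`, `Δ_G = lapAt`). [cite: SchoenYauPMT1979, §2 Step 1, (2.1) (p. 48)] -/
theorem exists_radius_lapAt_hCoeff_inv_norm_le {M : ℝ}
    (hAS : IsAsymptoticallySchwarzschild e D M 2) (hM : M < 0) :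
    ∃ σ : ℝ, e.R ≤ σ ∧ ∀ y : E3, σ ≤ ‖y‖ →
      lapAt (hCoeff e D) (fun z : E3 ↦ ‖z‖⁻¹) y ≤ M / 2 * (‖y‖ ^ 4)⁻¹ ∧
        lapAt (hCoeff e D) (fun z : E3 ↦ ‖z‖⁻¹) y < 0 := by
  obtain ⟨σ₀, hσ₀⟩ := exists_radius_of_eventually (e.eventually_lapAt_hCoeff_inv_norm_le D hAS hM)
  refine ⟨max σ₀ e.R, le_max_right _ _, fun y hy ↦ ?_⟩
  have h := hσ₀ y ((le_max_left _ _).trans hy)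
  refine ⟨h, h.trans_lt ?_⟩
  have hypos : 0 < ‖y‖ := e.R_pos.trans_le ((le_max_right _ _).trans hy)
  have : 0 < (‖y‖ ^ 4)⁻¹ := by positivity
  exact mul_neg_of_neg_of_pos (by linarith) this

end AFEnd

end Literature.Geometry.Lorentzian

end
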